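import Summits.BirchSwinnertonDyer.BirchSwinnertonDyer.Theses.ErratumRoadFive
import Literature.NumberTheory.EllipticCurves.SkinnerUrban2014.CofinitelyGeneratedSelmerProofs
import HarnessLib

/-!
# Route `ErratumRoadFive` (rung K2, `p ≥ 5`): the GLUE ITEM of the split of support
# `RoadFFPublishedInputs` (item stmt-BirchSwinnertonDyer-20431 `RoadFFPublishedInputsGlue`, planner g32 rev 36)

`RoadFFPublishedInputsGlue : JSWSigmaChangeNoTamagawaDefect → SUShapiroBigSelmer → RoadFFPublishedInputs`
(route-file decls: the two children are the Literature facts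
`JetchevSkinnerWan2017.prop332_charIdeal_XAc_sigma_change_of_noTamagawaDefect` and
`SkinnerUrban2014.prop323_XAc_equiv_XBigDecomp` BY NAME; the parent is their conjunction with
`SkinnerUrban2014.lemma319_finite_XBig`). The third conjunct is a THEOREM of the tree
(`SkinnerUrban2014.lemma319_finite_XBig_holds`, defn-ty1 g4 p523055), so the glue is the one-line term
`⟨h₁, h₂, lemma319_finite_XBig_holds⟩`. Pure glue; the CONDITIONAL content lives in the two children;
nothing is asserted about any curve; BSD is not advanced (T7). Cell `bsd-stepL`, seat `bsd-stepL-imc-p1`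
(prover g12, 2026-08-27).
-/

set_option autoImplicit false
set_option linter.dupNamespace false

namespace Summit.BirchSwinnertonDyer.BirchSwinnertonDyer.Theorems

/-- The split glue of support `RoadFFPublishedInputs` (item 20431): the two published-input children and
the landed theorem `SkinnerUrban2014.lemma319_finite_XBig_holds` re-assemble the three-conjunct parent.
[cite: SkinnerUrban2014, Lemma 3.1.9 (p. 20)] -/
theorem roadFFPublishedInputsGlue_holds :
    Summit.BirchSwinnertonDyer.BirchSwinnertonDyer.Theses.ErratumRoadFive.RoadFFPublishedInputsGlue :=
  fun h₁ h₂ ↦ ⟨h₁, h₂, Literature.NumberTheory.EllipticCurves.SkinnerUrban2014.lemma319_finite_XBig_holds⟩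

end Summit.BirchSwinnertonDyer.BirchSwinnertonDyer.Theorems
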